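import Summits.Parity.GeneralizedHardyLittlewood.Theorems.BeyondDiagonalBeatsQuarter.OffDiagCoreWinBlockBound
import Summits.Parity.GeneralizedHardyLittlewood.Theorems.BeyondDiagonalBeatsQuarter.OffDiagCoreWinKernelBounds
import Summits.Parity.GeneralizedHardyLittlewood.Theorems.BeyondDiagonalBeatsQuarter.OffDiagUnitBoxIntegralBound
import HarnessLib

/-!
# Route `PrimeLevelFamEdge`, crux K_B (stmt-Parity-20343), line `diagonal_kernel_split` rev 4, plan Ω,
# node **L7d part 2, leaf G5 — one (block, k, w) piece of the windowed FL-family: the unit-box INTEGRAL bounded by a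
# τ-FREE aggregate expression** (L7D-PLAN rev 7 §7: G3 `norm_blockFamily_le` + G4a + F1c `norm_integral_integral_le_of_box`)

The integrand of G2a `coreWin_eq_sum_blocks_integral_family` vanishes off the open unit box (`unitBoxKernel_eq_zero_off_box`) and on
it is bounded by G3 with the member weights `‖c_x·Kern_x(τ)‖ ≤ ‖c_x‖·((d₁K₁/2)(d₂K₂/2))^{−1/2}(r+1)⁻¹` (`norm_unitBoxKernel_le`);
F1c integrates the bound:

* **`norm_integral_blockFamily_le`** — `‖∫dτ₁∫dτ₂ FAM_{b,k,w}‖ ≤ (3/2)·((3/2)·B_{b,k,w})`, `B` = G3's bound with τ-free member weights.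

What remains for `hFL` (via `hFL_of_coreWin_funded`): the sum over `(b,k,w)` of `B_{b,k,w}` in mainScale currency (aggregate fibre sup via
D6, active-`s` count, K2-type scales) — L7D-PLAN rev 7 §7 G4b/$.
Pure inequality bookkeeping; standard axioms. Helper toward `stub_offDiagBelowSlack_io`; closes nothing.
«The programme SEARCHES and TYPES; no claim about Landau–Siegel zeros, Theorems 1–2 of arXiv:2211.02515 or
a repaired Margin232 until a kernel theorem says so.»
-/

noncomputable section

open Finset Real Complex MeasureTheory Polynomial
open scoped Nat

namespace Summit.Parity.GeneralizedHardyLittlewood.Theorems.BeyondDiagonalBeatsQuarter.OffDiag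

open Literature.Analysis.FunctionSpaces (besselJ)
open Literature.Analysis.Calculus.WhitneyConvex (dyadicBump)
open Literature.NumberTheory.LFunctions Literature.NumberTheory.LFunctions.KMV2000
open Literature.NumberTheory.Sieve.FriedlanderIwaniecPrimes (fourier2 ker)
open Literature.NumberTheory.Sieve.LargeSieve (e sepCoeff sepWeight)
open PeterssonSplit (nearBoxes)

/-- Monotonicity of the aggregate expression in the member weights. [folklore] -/
theorem sqrt_sum_sq_fiber_mono {ι κ : Type*} (T : Finset κ) (fib : κ → Finset ι) {a a' : ι → ℝ}
    (h0 : ∀ x, 0 ≤ a x) (h : ∀ x, a x ≤ a' x) :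
    Real.sqrt (∑ k ∈ T, (∑ x ∈ fib k, a x) ^ 2) ≤ Real.sqrt (∑ k ∈ T, (∑ x ∈ fib k, a' x) ^ 2) := by
  refine Real.sqrt_le_sqrt (Finset.sum_le_sum fun k _ ↦ ?_)
  exact pow_le_pow_left₀ (Finset.sum_nonneg fun x _ ↦ h0 x) (Finset.sum_le_sum fun x _ ↦ h x) 2

open Classical in
/-- **One (block, k, w) piece: the unit-box integral bounded τ-free.** Hypotheses as in G3 `norm_blockFamily_le` (without a
box point). [cite: KowalskiMichelVanderKam2000, §6 p. 19 — derivation; Davenport1980, ch. 29 — derivation] -/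
theorem norm_integral_blockFamily_le (R : ℕ) (hR : 1 ≤ R) {D : ℕ → ℕ → ℕ → ℕ → ℕ → ℕ × ℕ → ℤ → ℤ → ℂ} {N H_D : ℕ} (hN : 1 ≤ N)
    (hH : H_D ≤ N) (T : ℕ → ℕ → ℕ → ℕ → ℕ → ℕ × ℕ → ℤ → ℕ) (G : Finset ℕ) {L : ℕ} (hL : 1 ≤ L) (hLN : L ≤ N)
    (hG : ∀ q ∈ G, q.Prime ∧ N < q ∧ q ≤ 2 * N) (b : ℕ) (Δ' ε₀ : ℝ) (k : ℕ) (w : ℕ × ℕ) {J : ℕ} (hJ : 1 ≤ J)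
    (hDH : ∀ r l m d₁ d₂ i h₁ s, D r l m d₁ d₂ i h₁ s ≠ 0 → |h₁| ≤ (H_D : ℤ))
    (hDρ : ∀ x ∈ memberSet G (2 * N) N (coreHeight ε₀) T Δ', D x.r x.l x.m x.d₁ x.d₂ x.i x.h₁ x.s ≠ 0 →
      (((N + b * L : ℕ) : ℝ))⁻¹ - (((N + b * L + (L - 1) + 1 : ℕ) : ℝ))⁻¹ ≤
        (((N + b * L + (L - 1) + 1 : ℕ) : ℝ))⁻¹ / (1 + 2 * (4 * π * Real.sqrt (((x.l / x.d₁ : ℕ) : ℝ) * (x.m / x.d₂ : ℕ) *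
            (2 * 2 ^ x.i.1) * (2 * 2 ^ x.i.2)) / ((x.r + 1 : ℕ) : ℝ)) * (((N + b * L + (L - 1) + 1 : ℕ) : ℝ))⁻¹ +
          4 * π * (2 * 2 ^ x.i.1 * |(x.h₁ : ℝ) / (x.r + 1)| +
            2 * 2 ^ x.i.2 * |((((x.l / x.d₁ : ℕ) : ℤ) * (x.m / x.d₂ : ℕ) : ℝ)) / ((x.h₁ : ℝ) * (x.r + 1))|) *
            (((N + b * L + (L - 1) + 1 : ℕ) : ℝ))⁻¹) / 2) :
    ‖∫ τ₁, ∫ τ₂, ∑ x ∈ memberSet G (2 * N) N (coreHeight ε₀) T Δ',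
        ((if Nat.Coprime (x.l / x.d₁) (x.r + 1) then (1 : ℂ) else 0) *
          ((if IsUnit ((x.h₁ : ℤ) : ZMod (x.r + 1)) ∧ x.h₁ ≠ 0 then (1 : ℂ) else 0) *
            (if ((switchGcd (x.r + 1) x.s x.h₁ : ℤ) ∣ ((x.l / x.d₁ : ℕ) : ℤ) * (x.m / x.d₂ : ℕ) ∧
                IsUnit (switchClass (x.r + 1) (((x.l / x.d₁ : ℕ) : ℤ) * (x.m / x.d₂ : ℕ)) x.s x.h₁)) then (1 : ℂ) else 0) *
            D x.r x.l x.m x.d₁ x.d₂ x.i x.h₁ x.s) *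
          convexCoeff (fun q ↦ (coreRange Δ' ε₀ x.r x.l x.m x.d₁ x.d₂ x.i x.h₁ q ∧
              ¬ ((T x.r x.l x.m x.d₁ x.d₂ x.i x.h₁ : ℝ) <
                |(x.s : ℝ) + ((((x.l / x.d₁ : ℕ) : ℤ) * (x.m / x.d₂ : ℕ) : ℤ) : ℝ) / ((q * (x.r + 1) : ℕ) : ℝ)|)) ∧
              (N + b * L ≤ q ∧ q ≤ N + b * L + (L - 1))) (2 * N + 1) k *
          ((trinomCoeff x.l w.1 * trinomCoeff x.m w.2 : ℝ) : ℂ) *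
          (((2 : ℝ) ^ x.i.1 * 2 ^ x.i.2 : ℝ) : ℂ)) *
        ((((dyadicBump τ₁ * dyadicBump τ₂ *
            (((x.d₁ : ℝ) * (2 ^ x.i.1 * τ₁) * ((x.d₂ : ℝ) * (2 ^ x.i.2 * τ₂))) ^ (-(1 / 2 : ℝ)) *
              (((x.r + 1 : ℕ) : ℝ))⁻¹) : ℝ) : ℂ) * ker (2 ^ x.i.2 * τ₂) ((x.s : ℝ) / x.h₁)) *
          levelLargePart R (G.filter (fun q ↦ (q - N) / L = b))
            (fun q ↦ (e ((k : ℝ) * q / (2 * N + 1 : ℕ)) * (2 * (qhat q : ℂ) * (2 * π / q)) *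
                (((Real.log (qhat q ^ Δ'))⁻¹ ^ (w.1 + w.2) : ℝ) : ℂ)) *
              (((cutoffW ((4 * π ^ 2 * ((x.d₁ : ℝ) * (2 ^ x.i.1 * τ₁) * ((x.d₂ : ℝ) * (2 ^ x.i.2 * τ₂)))) *
                  ((q : ℝ))⁻¹) : ℝ) : ℂ) *
                ((besselJ 1 ((4 * π * Real.sqrt (((x.l / x.d₁ : ℕ) : ℝ) * (2 ^ x.i.1 * τ₁) *
                    (((x.m / x.d₂ : ℕ) : ℝ) * (2 ^ x.i.2 * τ₂))) / ((x.r + 1 : ℕ) : ℝ)) * ((q : ℝ))⁻¹) : ℝ) : ℂ) *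
                  Complex.exp (((-2 * π * ((2 ^ x.i.1 * τ₁) * ((x.h₁ : ℝ) / (x.r + 1)) +
                      (2 ^ x.i.2 * τ₂) * ((((x.l / x.d₁ : ℕ) : ℤ) * (x.m / x.d₂ : ℕ) : ℝ) / ((x.h₁ : ℝ) * (x.r + 1)))) *
                    ((q : ℝ))⁻¹ : ℝ) : ℂ) * I)))
            (switchMod (x.r + 1) x.s x.h₁)
            (switchClass (x.r + 1) (((x.l / x.d₁ : ℕ) : ℤ) * (x.m / x.d₂ : ℕ)) x.s x.h₁))‖ ≤
      3 / 2 * (3 / 2 * (      (∑ j ∈ Finset.range J, (1 / 2 : ℝ) ^ j *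
          Real.sqrt (∑ q ∈ G.filter (fun q ↦ (q - N) / L = b),
            ‖(e ((k : ℝ) * q / (2 * N + 1 : ℕ)) * (2 * (qhat q : ℂ) * (2 * π / q)) *
                (((Real.log (qhat q ^ Δ'))⁻¹ ^ (w.1 + w.2) : ℝ) : ℂ)) *
              ((((((q : ℝ))⁻¹ - (((N + b * L + (L - 1) + 1 : ℕ) : ℝ))⁻¹) /
                ((((N + b * L : ℕ) : ℝ))⁻¹ - (((N + b * L + (L - 1) + 1 : ℕ) : ℝ))⁻¹)) ^ j : ℝ) : ℂ)‖ ^ 2)) *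
        (Real.sqrt (∑ h ∈ Finset.Icc 1 H_D, ∑ c' ∈ (Finset.range h).filter (fun c' ↦ c'.Coprime h),
            (∑ x ∈ ((memberSet G (2 * N) N (coreHeight ε₀) T Δ').filter (fun x ↦ x.h₁ ≠ 0 ∧
                (((switchGcd (x.r + 1) x.s x.h₁ : ℤ) ∣ ((x.l / x.d₁ : ℕ) : ℤ) * (x.m / x.d₂ : ℕ) ∧
                  IsUnit (switchClass (x.r + 1) (((x.l / x.d₁ : ℕ) : ℤ) * (x.m / x.d₂ : ℕ)) x.s x.h₁))) ∧
                D x.r x.l x.m x.d₁ x.d₂ x.i x.h₁ x.s ≠ 0)).filter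
                (fun x ↦ switchMod (x.r + 1) x.s x.h₁ = h ∧
                  (switchClass (x.r + 1) (((x.l / x.d₁ : ℕ) : ℤ) * (x.m / x.d₂ : ℕ)) x.s x.h₁).val = c'),
              ‖((if Nat.Coprime (x.l / x.d₁) (x.r + 1) then (1 : ℂ) else 0) *
                  ((if IsUnit ((x.h₁ : ℤ) : ZMod (x.r + 1)) ∧ x.h₁ ≠ 0 then (1 : ℂ) else 0) *
                    (if ((switchGcd (x.r + 1) x.s x.h₁ : ℤ) ∣ ((x.l / x.d₁ : ℕ) : ℤ) * (x.m / x.d₂ : ℕ) ∧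
                        IsUnit (switchClass (x.r + 1) (((x.l / x.d₁ : ℕ) : ℤ) * (x.m / x.d₂ : ℕ)) x.s x.h₁)) then (1 : ℂ) else 0) *
                    D x.r x.l x.m x.d₁ x.d₂ x.i x.h₁ x.s) *
                  convexCoeff (fun q ↦ (coreRange Δ' ε₀ x.r x.l x.m x.d₁ x.d₂ x.i x.h₁ q ∧
                      ¬ ((T x.r x.l x.m x.d₁ x.d₂ x.i x.h₁ : ℝ) <
                        |(x.s : ℝ) + ((((x.l / x.d₁ : ℕ) : ℤ) * (x.m / x.d₂ : ℕ) : ℤ) : ℝ) / ((q * (x.r + 1) : ℕ) : ℝ)|)) ∧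
                      (N + b * L ≤ q ∧ q ≤ N + b * L + (L - 1))) (2 * N + 1) k *
                  ((trinomCoeff x.l w.1 * trinomCoeff x.m w.2 : ℝ) : ℂ) *
                  (((2 : ℝ) ^ x.i.1 * 2 ^ x.i.2 : ℝ) : ℂ))‖ *
                (((x.d₁ : ℝ) * (2 ^ x.i.1 * (1 / 2)) * ((x.d₂ : ℝ) * (2 ^ x.i.2 * (1 / 2)))) ^ (-(1 / 2 : ℝ)) *
                  (((x.r + 1 : ℕ) : ℝ))⁻¹)) ^ 2) *
          ((1 + Real.log H_D) * Real.sqrt (2 * ((N : ℝ) + 1) / R + 4 * H_D))) +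
        J * (1 / 2) ^ J * (∑ x ∈ (memberSet G (2 * N) N (coreHeight ε₀) T Δ').filter (fun x ↦ x.h₁ ≠ 0 ∧
                (((switchGcd (x.r + 1) x.s x.h₁ : ℤ) ∣ ((x.l / x.d₁ : ℕ) : ℤ) * (x.m / x.d₂ : ℕ) ∧
                  IsUnit (switchClass (x.r + 1) (((x.l / x.d₁ : ℕ) : ℤ) * (x.m / x.d₂ : ℕ)) x.s x.h₁))) ∧
                D x.r x.l x.m x.d₁ x.d₂ x.i x.h₁ x.s ≠ 0),
              ‖((if Nat.Coprime (x.l / x.d₁) (x.r + 1) then (1 : ℂ) else 0) *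
                  ((if IsUnit ((x.h₁ : ℤ) : ZMod (x.r + 1)) ∧ x.h₁ ≠ 0 then (1 : ℂ) else 0) *
                    (if ((switchGcd (x.r + 1) x.s x.h₁ : ℤ) ∣ ((x.l / x.d₁ : ℕ) : ℤ) * (x.m / x.d₂ : ℕ) ∧
                        IsUnit (switchClass (x.r + 1) (((x.l / x.d₁ : ℕ) : ℤ) * (x.m / x.d₂ : ℕ)) x.s x.h₁)) then (1 : ℂ) else 0) *
                    D x.r x.l x.m x.d₁ x.d₂ x.i x.h₁ x.s) *
                  convexCoeff (fun q ↦ (coreRange Δ' ε₀ x.r x.l x.m x.d₁ x.d₂ x.i x.h₁ q ∧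
                      ¬ ((T x.r x.l x.m x.d₁ x.d₂ x.i x.h₁ : ℝ) <
                        |(x.s : ℝ) + ((((x.l / x.d₁ : ℕ) : ℤ) * (x.m / x.d₂ : ℕ) : ℤ) : ℝ) / ((q * (x.r + 1) : ℕ) : ℝ)|)) ∧
                      (N + b * L ≤ q ∧ q ≤ N + b * L + (L - 1))) (2 * N + 1) k *
                  ((trinomCoeff x.l w.1 * trinomCoeff x.m w.2 : ℝ) : ℂ) *
                  (((2 : ℝ) ^ x.i.1 * 2 ^ x.i.2 : ℝ) : ℂ))‖ *
                (((x.d₁ : ℝ) * (2 ^ x.i.1 * (1 / 2)) * ((x.d₂ : ℝ) * (2 ^ x.i.2 * (1 / 2)))) ^ (-(1 / 2 : ℝ)) *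
                  (((x.r + 1 : ℕ) : ℝ))⁻¹)) *
          ∑ q ∈ G.filter (fun q ↦ (q - N) / L = b),
            ‖e ((k : ℝ) * q / (2 * N + 1 : ℕ)) * (2 * (qhat q : ℂ) * (2 * π / q)) *
                (((Real.log (qhat q ^ Δ'))⁻¹ ^ (w.1 + w.2) : ℝ) : ℂ)‖)) := by
  set M := memberSet G (2 * N) N (coreHeight ε₀) T Δ' with hM
  refine norm_integral_integral_le_of_box (fun τ₁ τ₂ hoff ↦ ?_) (fun τ₁ τ₂ hτ₁ hτ₂ ↦ ?_)
  · -- off the box every member's kernel vanishes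
    refine Finset.sum_eq_zero fun x _ ↦ ?_
    rw [unitBoxKernel_eq_zero_off_box x.d₁ x.d₂ x.r x.i ((x.s : ℝ) / x.h₁) hoff, zero_mul, mul_zero]
  · -- on the box: G3, then the τ-free kernel majorant
    have hG3 := norm_blockFamily_le R hR hN hH T G hL hLN hG b Δ' ε₀ k w hJ
      (Set.Ioo_subset_Icc_self hτ₁) (Set.Ioo_subset_Icc_self hτ₂) hDH hDρ
    refine hG3.trans ?_
    have hKB : ∀ x ∈ M, ∀ (c : ℂ), (‖c * (((dyadicBump τ₁ * dyadicBump τ₂ *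
        (((x.d₁ : ℝ) * (2 ^ x.i.1 * τ₁) * ((x.d₂ : ℝ) * (2 ^ x.i.2 * τ₂))) ^ (-(1 / 2 : ℝ)) *
          (((x.r + 1 : ℕ) : ℝ))⁻¹) : ℝ) : ℂ) * ker (2 ^ x.i.2 * τ₂) ((x.s : ℝ) / x.h₁))‖ ≤
        ‖c‖ * ((((x.d₁ : ℝ) * (2 ^ x.i.1 * (1 / 2)) * ((x.d₂ : ℝ) * (2 ^ x.i.2 * (1 / 2)))) ^ (-(1 / 2 : ℝ)) *
          (((x.r + 1 : ℕ) : ℝ))⁻¹))) := by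
      intro x hx c
      obtain ⟨-, hl, hm, hd₁, hd₂, -, -, -⟩ := mem_memberSet hx
      rw [norm_mul]
      exact mul_le_mul_of_nonneg_left (norm_unitBoxKernel_le (Nat.pos_of_mem_divisors hd₁) (Nat.pos_of_mem_divisors hd₂)
        x.r x.i _ hτ₁.1 hτ₂.1) (norm_nonneg _)
    have hfilt : ∀ x ∈ M.filter (fun x ↦ x.h₁ ≠ 0 ∧
        (((switchGcd (x.r + 1) x.s x.h₁ : ℤ) ∣ ((x.l / x.d₁ : ℕ) : ℤ) * (x.m / x.d₂ : ℕ) ∧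
          IsUnit (switchClass (x.r + 1) (((x.l / x.d₁ : ℕ) : ℤ) * (x.m / x.d₂ : ℕ)) x.s x.h₁))) ∧
        D x.r x.l x.m x.d₁ x.d₂ x.i x.h₁ x.s ≠ 0), x ∈ M := fun x hx ↦ (Finset.mem_filter.mp hx).1
    have hKB' : ∀ x ∈ M.filter (fun x ↦ x.h₁ ≠ 0 ∧
        (((switchGcd (x.r + 1) x.s x.h₁ : ℤ) ∣ ((x.l / x.d₁ : ℕ) : ℤ) * (x.m / x.d₂ : ℕ) ∧
          IsUnit (switchClass (x.r + 1) (((x.l / x.d₁ : ℕ) : ℤ) * (x.m / x.d₂ : ℕ)) x.s x.h₁))) ∧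
        D x.r x.l x.m x.d₁ x.d₂ x.i x.h₁ x.s ≠ 0), ∀ (c : ℂ), (‖c * (((dyadicBump τ₁ * dyadicBump τ₂ *
        (((x.d₁ : ℝ) * (2 ^ x.i.1 * τ₁) * ((x.d₂ : ℝ) * (2 ^ x.i.2 * τ₂))) ^ (-(1 / 2 : ℝ)) *
          (((x.r + 1 : ℕ) : ℝ))⁻¹) : ℝ) : ℂ) * ker (2 ^ x.i.2 * τ₂) ((x.s : ℝ) / x.h₁))‖ ≤
        ‖c‖ * ((((x.d₁ : ℝ) * (2 ^ x.i.1 * (1 / 2)) * ((x.d₂ : ℝ) * (2 ^ x.i.2 * (1 / 2)))) ^ (-(1 / 2 : ℝ)) *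
          (((x.r + 1 : ℕ) : ℝ))⁻¹))) := fun x hx c ↦ hKB x (hfilt x hx) c
    have hlog : 0 ≤ (1 + Real.log H_D) * Real.sqrt (2 * ((N : ℝ) + 1) / R + 4 * H_D) := by
      have := Real.log_natCast_nonneg H_D; positivity
    refine add_le_add ?_ ?_
    · refine mul_le_mul_of_nonneg_left (mul_le_mul_of_nonneg_right ?_ hlog) (Finset.sum_nonneg fun j _ ↦ by positivity)
      refine Real.sqrt_le_sqrt (Finset.sum_le_sum fun h _ ↦ Finset.sum_le_sum fun c' _ ↦ ?_)
      refine pow_le_pow_left₀ (Finset.sum_nonneg fun x _ ↦ norm_nonneg _) (Finset.sum_le_sum fun x hx ↦ ?_) 2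
      exact hKB' x (Finset.mem_filter.mp hx).1 _
    · refine mul_le_mul_of_nonneg_right (mul_le_mul_of_nonneg_left (Finset.sum_le_sum fun x hx ↦ ?_) (by positivity))
        (Finset.sum_nonneg fun q _ ↦ norm_nonneg _)
      exact hKB' x hx _

end Summit.Parity.GeneralizedHardyLittlewood.Theorems.BeyondDiagonalBeatsQuarter.OffDiag
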